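import Summits.Ventures.HodgeRepro2.T5Sl2LowestWeightModel

/-!
# The model of the lowest-weight `sl₂(K)`-module is irreducible; its weights

Continuation of `T5Sl2LowestWeightModel` (Tier-5 support, N4.3 = (R3), step (P2′);
route/T5-SUPPORT-p1.md §S4).  For the model `Model K μ` on `ℕ →₀ K` with basis `vₙ`:

* `toEnd_f₀_pow_apply` / `toEnd_e₀_pow_v`: the powers of `f₀` act as the powers of `F₀`, and
  `e₀ᵏ v₀ = vₖ`;
* `F₀_pow_single_self` / `F₀_pow_single_of_lt` / `F₀_pow_max` (descent): for `w ≠ 0` with top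
  index `n`, `F₀ⁿ w = (dcoeff n · w n) • v₀` with `dcoeff n = ∏_{j < n} (j + 1)(−μ − j) ≠ 0`
  when `μ ∉ −ℕ`;
* `isIrreducible`: for `μ ∉ −ℕ` the module is irreducible — a non-zero Lie submodule contains
  `v₀` by descent, hence every `vₖ` by climbing with `e₀`, hence everything;
* `isIrreducible_three`, `hasEigenvalue_h₀_iff_model`, `hasEigenvalue_h₀_iff_model_three`: the
  general theorems of `T5Sl2Standard` instantiated on the model — the `h₀`-eigenvalues are
  `μ, μ + 2, …`, for `μ = 3` exactly `3, 5, 7, …`.  Together with `T5Sl2LowestWeightUnique`,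
  the model of weight `3` is THE irreducible lowest-weight-`3` module, up to isomorphism.

What this file does NOT say: anything about `π₃⁺` itself — that its `K`-finite vectors are this
module (for `μ = 3`) is the printed input [C] of (P2′).

Blind lane: Mathlib + own prefix; no sorry; axioms ⊆ {propext, Classical.choice, Quot.sound}.
-/

namespace Summit.Ventures.HodgeRepro2.T5Sl2LowestWeightModelIrreducible

noncomputable section

open LieAlgebra.SpecialLinear LieModule Module
open Summit.Ventures.HodgeRepro2.T5Sl2Standard Summit.Ventures.HodgeRepro2.T5Sl2LowestWeight
  Summit.Ventures.HodgeRepro2.T5Sl2LowestWeightModel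

section Descent

variable (K : Type*) [Field K] (μ : K)

/-- The action of `f₀` on the model is `F₀`. -/
lemma toEnd_f₀_apply (w : Model K μ) :
    toEnd K (sl (Fin 2) K) (Model K μ) (f₀ K) w = F₀ K μ (toFinsupp K μ w) := by
  rw [toEnd_apply_apply, lie_eq, rho_f₀]
  rfl

/-- The powers of `f₀` act as the powers of `F₀`. -/
lemma toEnd_f₀_pow_apply (k : ℕ) (w : Model K μ) :
    (toEnd K (sl (Fin 2) K) (Model K μ) (f₀ K) ^ k) w = (F₀ K μ ^ k) (toFinsupp K μ w) := by
  induction k generalizing w with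
  | zero => rfl
  | succ k ih =>
    rw [pow_succ, pow_succ, Module.End.mul_apply, Module.End.mul_apply, toEnd_f₀_apply]
    exact ih _

/-- `e₀ᵏ v₀ = vₖ`. -/
lemma toEnd_e₀_pow_v (k : ℕ) :
    (toEnd K (sl (Fin 2) K) (Model K μ) (e₀ K) ^ k) (v K μ 0) = v K μ k := by
  induction k with
  | zero => rfl
  | succ k ih => rw [pow_succ', Module.End.mul_apply, ih, toEnd_apply_apply, lie_e₀_v]

/-- The product `∏_{j < n} (j + 1)(−μ − j)` of the lowering coefficients. -/
def dcoeff (n : ℕ) : K := ∏ j ∈ Finset.range n, (((j : K) + 1) * (-μ - j))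

/-- `dcoeff ≠ 0` when `μ ∉ −ℕ`. -/
lemma dcoeff_ne_zero [CharZero K] (hμ : ∀ n : ℕ, μ ≠ -(n : K)) (n : ℕ) : dcoeff K μ n ≠ 0 :=
  Finset.prod_ne_zero_iff.mpr fun j _ => coeff_ne_zero hμ j

/-- `F₀ⁿ (single n c) = (dcoeff n · c) • single 0 1`. -/
lemma F₀_pow_single_self (n : ℕ) (c : K) :
    (F₀ K μ ^ n) (Finsupp.single n c) = (dcoeff K μ n * c) • Finsupp.single 0 (1 : K) := by
  induction n generalizing c with
  | zero => simp [dcoeff]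
  | succ n ih =>
    rw [pow_succ, Module.End.mul_apply, F₀_single_succ, ih]
    simp only [dcoeff, Finset.prod_range_succ]
    congr 1
    ring

/-- `F₀ⁿ (single k c) = 0` for `k < n`. -/
lemma F₀_pow_single_of_lt {k n : ℕ} (h : k < n) (c : K) :
    (F₀ K μ ^ n) (Finsupp.single k c) = 0 := by
  induction n generalizing k c with
  | zero => exact absurd h (Nat.not_lt_zero k)
  | succ n ih =>
    rw [pow_succ, Module.End.mul_apply]
    rcases k with _ | k
    · rw [F₀_single_zero, map_zero]
    · rw [F₀_single_succ]
      exact ih (Nat.lt_of_succ_lt_succ h) _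

/-- `F₀ⁿ w = 0` when every index in the support of `w` is `< n`. -/
lemma F₀_pow_eq_zero_of_support_lt (n : ℕ) (w : ℕ →₀ K) (hw : ∀ k ∈ w.support, k < n) :
    (F₀ K μ ^ n) w = 0 := by
  induction w using Finsupp.induction with
  | zero => exact map_zero _
  | single_add a b f ha hb ih =>
    have hsupp : (Finsupp.single a b + f).support = {a} ∪ f.support := by
      rw [Finsupp.support_add_eq, Finsupp.support_single a hb]
      rw [Finsupp.support_single a hb]
      exact Finset.disjoint_singleton_left.mpr ha
    rw [hsupp] at hw
    rw [map_add, ih fun k hk => hw k (Finset.mem_union_right _ hk),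
      F₀_pow_single_of_lt K μ (hw a (Finset.mem_union_left _ (Finset.mem_singleton_self a))) b,
      add_zero]

/-- Descent: for `w ≠ 0` with top index `n = max (support w)`,
`F₀ⁿ w = (dcoeff n · w n) • single 0 1`. -/
lemma F₀_pow_max (w : ℕ →₀ K) (hw : w ≠ 0) :
    (F₀ K μ ^ w.support.max' (Finsupp.support_nonempty_iff.mpr hw)) w =
      (dcoeff K μ (w.support.max' (Finsupp.support_nonempty_iff.mpr hw)) *
        w (w.support.max' (Finsupp.support_nonempty_iff.mpr hw))) • Finsupp.single 0 (1 : K) := by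
  set n := w.support.max' (Finsupp.support_nonempty_iff.mpr hw) with hn
  have hsplit : w = Finsupp.single n (w n) + w.erase n := (Finsupp.single_add_erase n w).symm
  have hrest : (F₀ K μ ^ n) (w.erase n) = 0 := by
    refine F₀_pow_eq_zero_of_support_lt K μ n _ fun k hk => ?_
    rw [Finsupp.support_erase, Finset.mem_erase] at hk
    exact lt_of_le_of_ne (Finset.le_max' _ _ hk.2) hk.1
  conv_lhs => rw [hsplit]
  rw [map_add, hrest, add_zero, F₀_pow_single_self]

end Descent

section Irreducible

variable (K : Type*) [Field K] (μ : K)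

/-- `vₖ ∈ N` for every Lie submodule `N` containing `v₀`. -/
lemma v_mem_of_v_zero_mem (N : LieSubmodule K (sl (Fin 2) K) (Model K μ)) (h0 : v K μ 0 ∈ N)
    (k : ℕ) : v K μ k ∈ N := by
  induction k with
  | zero => exact h0
  | succ k ih => rw [← lie_e₀_v]; exact N.lie_mem ih

/-- A Lie submodule containing `v₀` is everything. -/
lemma eq_top_of_v_zero_mem (N : LieSubmodule K (sl (Fin 2) K) (Model K μ)) (h0 : v K μ 0 ∈ N) :
    N = ⊤ := by
  rw [eq_top_iff]
  intro w _
  suffices h : ∀ w : ℕ →₀ K, (show Model K μ from w) ∈ N from h w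
  intro w
  induction w using Finsupp.induction_linear with
  | zero => exact N.zero_mem
  | add f g hf hg => exact N.add_mem hf hg
  | single a b =>
    rw [← smul_v]
    exact N.smul_mem b (v_mem_of_v_zero_mem K μ N h0 a)

/-- `xᵏ w ∈ N` for `w ∈ N` (a Lie submodule is stable under the powers of the action). -/
lemma toEnd_pow_mem (N : LieSubmodule K (sl (Fin 2) K) (Model K μ)) (x : sl (Fin 2) K)
    {w : Model K μ} (hw : w ∈ N) (k : ℕ) :
    (toEnd K (sl (Fin 2) K) (Model K μ) x ^ k) w ∈ N := by
  induction k with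
  | zero => simpa using hw
  | succ k ih => rw [pow_succ', Module.End.mul_apply, toEnd_apply_apply]; exact N.lie_mem ih

/-- **Irreducibility** of the model for `μ ∉ −ℕ`. -/
theorem isIrreducible [CharZero K] (hμ : ∀ n : ℕ, μ ≠ -(n : K)) :
    LieModule.IsIrreducible K (sl (Fin 2) K) (Model K μ) := by
  refine LieModule.IsIrreducible.mk fun N hN => ?_
  obtain ⟨w, hwN, hw⟩ : ∃ w ∈ N, w ≠ 0 := by
    by_contra hcon
    push Not at hcon
    exact hN ((LieSubmodule.eq_bot_iff N).mpr hcon)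
  have hw' : toFinsupp K μ w ≠ 0 := hw
  set n := (toFinsupp K μ w).support.max' (Finsupp.support_nonempty_iff.mpr hw') with hn
  have hdesc : (dcoeff K μ n * toFinsupp K μ w n) • v K μ 0 ∈ N := by
    have h1 := toEnd_pow_mem K μ N (f₀ K) hwN n
    rw [toEnd_f₀_pow_apply] at h1
    have h2 := F₀_pow_max K μ (toFinsupp K μ w) hw'
    rw [← hn] at h2
    rw [h2] at h1
    exact h1
  have hne : dcoeff K μ n * toFinsupp K μ w n ≠ 0 :=
    mul_ne_zero (dcoeff_ne_zero K μ hμ n)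
      (Finsupp.mem_support_iff.mp (Finset.max'_mem _ (Finsupp.support_nonempty_iff.mpr hw')))
  have h0 : v K μ 0 ∈ N := by
    rw [← LieSubmodule.mem_toSubmodule] at hdesc ⊢
    exact ((N : Submodule K (Model K μ)).smul_mem_iff hne).mp hdesc
  exact eq_top_of_v_zero_mem K μ N h0

/-- The model of weight `3` is irreducible (characteristic zero). -/
theorem isIrreducible_three [CharZero K] :
    LieModule.IsIrreducible K (sl (Fin 2) K) (Model K (3 : K)) :=
  isIrreducible K 3 three_ne_neg

/-- On the model of weight `μ ∉ −ℕ`, the `h₀`-eigenvalues are exactly `μ, μ + 2, …`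
(`T5Sl2Standard.hasEigenvalue_h₀_iff` instantiated). -/
theorem hasEigenvalue_h₀_iff_model [CharZero K] (hμ : ∀ n : ℕ, μ ≠ -(n : K)) (c : K) :
    (toEnd K (sl (Fin 2) K) (Model K μ) (h₀ K)).HasEigenvalue c ↔ ∃ n : ℕ, c = μ + 2 * n :=
  haveI := isIrreducible K μ hμ
  hasEigenvalue_h₀_iff (hasLowestWeightVector K μ) hμ c

/-- On the model of weight `3`, the `h₀`-eigenvalues are exactly `3, 5, 7, …`. -/
theorem hasEigenvalue_h₀_iff_model_three [CharZero K] (c : K) :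
    (toEnd K (sl (Fin 2) K) (Model K (3 : K)) (h₀ K)).HasEigenvalue c ↔ ∃ n : ℕ, c = 3 + 2 * n :=
  hasEigenvalue_h₀_iff_model K 3 three_ne_neg c

end Irreducible

end

end Summit.Ventures.HodgeRepro2.T5Sl2LowestWeightModelIrreducible
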